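import Summits.ResolutionOfSingularities.ResolutionOfSingularities.Theorems.EquisingularLiftEquisingularLiftNatSpecialFibreIso
import Summits.ResolutionOfSingularities.ResolutionOfSingularities.Theorems.EquisingularLiftEquisingularLiftNatDirZeroDefs
import Summits.ResolutionOfSingularities.ResolutionOfSingularities.Theorems.EquisingularLiftEquisingularLiftNatInCarrierCentre
import Literature.AlgebraicGeometry.Motives.ReducedClosedSubschemeIso
import Literature.AlgebraicGeometry.Resolution.AlterationsStrictTransformModel
import Literature.AlgebraicGeometry.Resolution.ComponentGluing
import HarnessLib

/-!
# [OURS · L1 W4.5(b) · EL♮(3)] S6 (b) — PUSHING THE SECTION TO THE ROOT: the downstairs inputs of T-DIRLIFT-UP at the root of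
# `DirLift.Ruled` from the stage's round data (`DirStepSec`, regularity along `Z`) along the special-fibre bridge `ε : Ẽ ≅ Ẽ₁`

Crux chain w45b (cell `res-hironaka`, slot W4.5(b)), working crux **EL♮** = stmt-ResolutionOfSingularities-20038, child **EL♮(3)** =
stmt-ResolutionOfSingularities-20148, route EquisingularLift, line `sections`; rung TOWER₃, stand-in S6 `hCech` (res-D-pv-029's
`…NatTowerAssembly`), its named input **(N1) `hCentre`** of res-D-pv-057's `Tower.inv₂_cechRound_new` (p568199) = «T-DIRLIFT at a transported
stage», to be assembled as `Tower.hCentre_of` (res-D-pv-057, 2026-08-27T20:42:18Z) from res-L1-w45b-stub-2's decomposition (a)–(d)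
(STATUS 20:25:39Z). This file is part **(b) «push the section to the root»**, written by res-L1-w45b-stub-2 g7. HONEST FRAMING: OURS; NOT a
statement of any manuscript; AI-written, weaker than expert review. No `sorry`; standard axioms. DEF-FREE.
`--supports stmt-ResolutionOfSingularities-20148 --as helper`.

SETTING (downstairs only). The stage: special fibre `G`, its map `γ : G ⟶ F₁₀`, the exceptional surface `E ⊆ G` (closed) and the
round's curve `Z ⊆ E`, a SECTION over the carrier (`DirStepSec F₉ F₁₀ υ' Z₉ hZ₉ G γ Z hZ`: `δ : Z̃ ≅ Z̃₉` over `γ ≫ υ'`). The root of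
`DirLift.Ruled` (R2/R2′, unpacked): `γ₀ : G₀ ⟶ F₉` with `δ₀ : Z̃₀ ≅ Z̃₉` over `γ₀`, the downstairs blow-up `υ₁ : G₁ ⟶ G₀`, the comparison
`ϱ : G ⟶ G₁` with `ϱ ≫ υ₁ ≫ γ₀ = γ ≫ υ'`, and the special-fibre bridge `ε : Ẽ = redSub G E ⟶ Ẽ₁ = redSub G₁ E₁` over `ϱ`, an isomorphism
(…NatSpecialFibreIso p567357 from the cartesian square `(jG, ϱ, ρ, j₁)` and R1′'s iso `V(𝓔) ≅ V(I·𝒪_{X₁})` over `ρ`).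

WHAT (namespace `…Cruxes.EquisingularLiftNat.Sections`).
* `exists_redSub_hom_of_subset` — the closed immersion `Z̃ ⟶ Ẽ` over `G` for `Z ⊆ E`; `exists_redSub_point`.
* `image_subset_of_redSub_hom_over`, `injOn_of_redSub_iso_over`, `inter_preimage_image_eq_of_redSub_iso_over` — set bookkeeping along `ε`
  (`ϱ '' E ⊆ E₁`, `ϱ` is injective on `E`, `E ∩ ϱ⁻¹(ϱ '' Z) = Z`: the input of …NatTransportedCentre's exact trace (c1)).
* `coe_support_comap_comap_eq_preimage` — `supp ((I·𝒪_{X₁})·𝒪_{G₁}) = υ₁⁻¹ Z₀` from `j₁ ≫ τ₀ = υ₁ ≫ j₀` and `I·𝒪_{G₀} = 𝓘⟨Z₀⟩`.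
* `comap_eq_vanishingIdeal_and_exists_isIso_redSub_of_iso_over` — **the root's exceptional trace is REDUCED** (`(I·𝒪_{X₁})·𝒪_{G₁} = 𝓘⟨E₁⟩`,
  because `V` of it is isomorphic to the reduced `V(𝓔·𝒪_G) = Ẽ` of the stage, (e-i)) **and the bridge `ε : Ẽ ≅ Ẽ₁` over `ϱ`**.
* **`exists_dirStepSec_root`** — the section at the root: `δ' : Z̃ ⟶ Z̃₀` over `φ = ϱ ≫ υ₁`, an isomorphism (`= δ ≫ δ₀⁻¹`; the lift exists
  because `Z̃` is reduced and `φ(Z) ⊆ Z₀`, and is `δ ≫ δ₀⁻¹` after the monomorphism `Z̃₀ ↪ G₀ → F₉ = δ₀ ≫ (Z̃₉ ↪ F₉)`).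
* `exists_isIso_redSub_image` — `εZ : Z̃ ≅ redSub G₁ (ϱ '' Z)` over `ϱ` (uniqueness of the reduced closed subscheme structure); with it
  `exists_dirStepSec_root_image` = T-DIRLIFT-UP's `hsec` VERBATIM for `Γ := ϱ '' Z` (sig `L/res-D-pv-051/TARGET-DIRLIFT-UP.sig.lean`
  9b7825e935ffb8f7), `isIrreducible_image`, and `forall_isRegularLocalRing_stalk_of_redSub_isos` = T-DIRLIFT-UP's `hEreg` for `Γ := ϱ '' Z`
  from `TowerRound₃`'s clause «`Ẽ` regular along `Z̃`».
NOT HERE (flagged on STATUS): T-DIRLIFT-UP's `hreg` («the ROOT's special fibre `G₁` is regular along `Γ`») is NOT a consequence of the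
round's clause «`G` regular along `Z̃`» at the STAGE (an intermediate Čech round through the point changes the ambient special fibre); and
`hunobs` (`DirStepUnobs`) transports along `ε` only through an isomorphism-invariance lemma for `HodgeTheory.normalSheaf` that the tree lacks.

References (index only): Hartshorne II Ex. 3.2.6 (reduced induced structure; Literature `Motives/ReducedClosedSubschemeIso`), Görtz–Wedhorn I
Prop. 4.20 (…NatSpecialFibreIso), Mathlib `IsClosedImmersion.lift`. [cite: Hartshorne1977, II Example 3.2.6] [cite: GortzWedhorn2020, Prop. 4.20]
-/

set_option linter.dupNamespace false -- mandated namespace `Summit.<Summit>.<Problem>` of this single-conjunct summit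

noncomputable section

open CategoryTheory CategoryTheory.Limits AlgebraicGeometry TopologicalSpace Topology
open Literature.AlgebraicGeometry.Resolution
open Literature.AlgebraicGeometry.Motives
open AlgebraicGeometry.Scheme.IdealSheafData

namespace Summit.ResolutionOfSingularities.ResolutionOfSingularities.Cruxes.EquisingularLiftNat.Sections

/-! ## 1. Reduced closed subschemes: points, inclusions, images -/

/-- A point of a closed subset is a point of its reduced closed subscheme. [folklore] -/
theorem exists_redSub_point {G : Scheme.{0}} {E : Set G} (hE : IsClosed E) {x : G} (hx : x ∈ E) :
    ∃ y : redSub G E hE, redSubι G E hE y = x := by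
  have h : x ∈ Set.range (redSubι G E hE) := by
    rw [Scheme.IdealSheafData.range_subschemeι, Scheme.IdealSheafData.coe_support_vanishingIdeal]; exact hx
  exact h

/-- A point of the reduced closed subscheme lies on the closed subset. [folklore] -/
theorem redSubι_mem {G : Scheme.{0}} {E : Set G} (hE : IsClosed E) (y : redSub G E hE) : redSubι G E hE y ∈ E := by
  have h : redSubι G E hE y ∈ Set.range (redSubι G E hE) := ⟨y, rfl⟩
  rw [Scheme.IdealSheafData.range_subschemeι, Scheme.IdealSheafData.coe_support_vanishingIdeal] at h
  exact h

/-- **The closed immersion `Z̃ ⟶ Ẽ` over `G`** of reduced closed subschemes, `Z ⊆ E`. [cite: Hartshorne1977, II Example 3.2.6] -/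
theorem exists_redSub_hom_of_subset {G : Scheme.{0}} {Z E : Set G} (hZ : IsClosed Z) (hE : IsClosed E) (hZE : Z ⊆ E) :
    ∃ i : redSub G Z hZ ⟶ redSub G E hE, i ≫ redSubι G E hE = redSubι G Z hZ ∧ IsClosedImmersion i := by
  have hker : (redSubι G E hE).ker ≤ (redSubι G Z hZ).ker := by
    rw [Scheme.IdealSheafData.ker_subschemeι, Scheme.IdealSheafData.ker_subschemeι]
    exact vanishingIdeal_antimono (show (⟨Z, hZ⟩ : Closeds G) ≤ ⟨E, hE⟩ from hZE)
  haveI : IsClosedImmersion (IsClosedImmersion.lift _ _ hker ≫ redSubι G E hE) := by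
    rw [IsClosedImmersion.lift_fac]; infer_instance
  exact ⟨IsClosedImmersion.lift _ _ hker, IsClosedImmersion.lift_fac _ _ hker,
    IsClosedImmersion.of_comp_isClosedImmersion _ (redSubι G E hE)⟩

/-- Along a morphism `ε : Ẽ ⟶ Ẽ₁` over `ϱ : G ⟶ G₁` the image of `E` lies in `E₁`. [folklore] -/
theorem image_subset_of_redSub_hom_over {G G₁ : Scheme.{0}} (ϱ : G ⟶ G₁) {E : Set G} (hE : IsClosed E) {E₁ : Set G₁}
    (hE₁ : IsClosed E₁) (ε : redSub G E hE ⟶ redSub G₁ E₁ hE₁) (hε : ε ≫ redSubι G₁ E₁ hE₁ = redSubι G E hE ≫ ϱ) :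
    ϱ '' E ⊆ E₁ := by
  rintro _ ⟨x, hx, rfl⟩
  obtain ⟨y, rfl⟩ := exists_redSub_point hE hx
  rw [← Scheme.Hom.comp_apply, ← hε, Scheme.Hom.comp_apply]
  exact redSubι_mem hE₁ _

/-- Along an ISOMORPHISM `ε : Ẽ ⟶ Ẽ₁` over `ϱ : G ⟶ G₁`, the map `ϱ` is injective on `E`. [folklore] -/
theorem injOn_of_redSub_iso_over {G G₁ : Scheme.{0}} (ϱ : G ⟶ G₁) {E : Set G} (hE : IsClosed E) {E₁ : Set G₁}
    (hE₁ : IsClosed E₁) (ε : redSub G E hE ⟶ redSub G₁ E₁ hE₁) [IsIso ε] (hε : ε ≫ redSubι G₁ E₁ hE₁ = redSubι G E hE ≫ ϱ) :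
    Set.InjOn ϱ E := by
  intro x hx x' hx' h
  obtain ⟨y, rfl⟩ := exists_redSub_point hE hx
  obtain ⟨y', rfl⟩ := exists_redSub_point hE hx'
  rw [← Scheme.Hom.comp_apply, ← Scheme.Hom.comp_apply, ← hε, Scheme.Hom.comp_apply, Scheme.Hom.comp_apply] at h
  rw [(ε ≫ redSubι G₁ E₁ hE₁).isClosedEmbedding.injective
    (show (ε ≫ redSubι G₁ E₁ hE₁) y = (ε ≫ redSubι G₁ E₁ hE₁) y' by rw [Scheme.Hom.comp_apply, Scheme.Hom.comp_apply, h])]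

/-- **`E ∩ ϱ⁻¹(ϱ(Z)) = Z`** for `Z ⊆ E` along an isomorphism `ε : Ẽ ≅ Ẽ₁` over `ϱ` (the exact-trace input of …NatTransportedCentre's
`transportedCentre_comap_eq_vanishingIdeal` with `Γ₁ := ϱ '' Z`). [folklore] -/
theorem inter_preimage_image_eq_of_redSub_iso_over {G G₁ : Scheme.{0}} (ϱ : G ⟶ G₁) {E : Set G} (hE : IsClosed E) {E₁ : Set G₁}
    (hE₁ : IsClosed E₁) (ε : redSub G E hE ⟶ redSub G₁ E₁ hE₁) [IsIso ε] (hε : ε ≫ redSubι G₁ E₁ hE₁ = redSubι G E hE ≫ ϱ)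
    {Z : Set G} (hZE : Z ⊆ E) : E ∩ ϱ ⁻¹' (ϱ '' Z) = Z := by
  ext x
  refine ⟨?_, fun hx => ⟨hZE hx, Set.mem_image_of_mem _ hx⟩⟩
  rintro ⟨hxE, z, hz, hzx⟩
  rwa [← injOn_of_redSub_iso_over ϱ hE hE₁ ε hε (hZE hz) hxE hzx]

/-- **The reduced closed subscheme on the image**: for `Z ⊆ E` and an isomorphism `ε : Ẽ ≅ Ẽ₁` over `ϱ`, the image `ϱ(Z)` is closed in
`G₁` and `Z̃ ≅ redSub G₁ (ϱ '' Z)` over `ϱ` (uniqueness of the reduced induced structure). [cite: Hartshorne1977, II Example 3.2.6] -/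
theorem exists_isIso_redSub_image {G G₁ : Scheme.{0}} (ϱ : G ⟶ G₁) {E : Set G} (hE : IsClosed E) {E₁ : Set G₁} (hE₁ : IsClosed E₁)
    (ε : redSub G E hE ⟶ redSub G₁ E₁ hE₁) [IsIso ε] (hε : ε ≫ redSubι G₁ E₁ hE₁ = redSubι G E hE ≫ ϱ)
    {Z : Set G} (hZ : IsClosed Z) (hZE : Z ⊆ E) :
    ∃ (hc : IsClosed (ϱ '' Z)) (εZ : redSub G Z hZ ⟶ redSub G₁ (ϱ '' Z) hc),
      εZ ≫ redSubι G₁ (ϱ '' Z) hc = redSubι G Z hZ ≫ ϱ ∧ IsIso εZ := by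
  obtain ⟨i, hi, hici⟩ := exists_redSub_hom_of_subset hZ hE hZE
  haveI := hici
  haveI : IsClosedImmersion (i ≫ ε ≫ redSubι G₁ E₁ hE₁) := inferInstance
  have hf : i ≫ ε ≫ redSubι G₁ E₁ hE₁ = redSubι G Z hZ ≫ ϱ := by rw [hε, ← Category.assoc, hi]
  have hrange : Set.range (i ≫ ε ≫ redSubι G₁ E₁ hE₁) = ϱ '' Z := by
    rw [hf, Scheme.Hom.comp_base, TopCat.coe_comp, Set.range_comp, Scheme.IdealSheafData.range_subschemeι,
      Scheme.IdealSheafData.coe_support_vanishingIdeal]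
    rfl
  have hc : IsClosed (ϱ '' Z) := hrange ▸ (i ≫ ε ≫ redSubι G₁ E₁ hE₁).isClosedEmbedding.isClosed_range
  haveI : IsReduced (redSub G Z hZ) := ComponentGluing.isReduced_subscheme_vanishingIdeal _
  haveI : IsReduced (redSub G₁ (ϱ '' Z) hc) := ComponentGluing.isReduced_subscheme_vanishingIdeal _
  obtain ⟨e', he'⟩ := exists_iso_of_isClosedImmersion_of_range_eq (redSubι G₁ (ϱ '' Z) hc) (i ≫ ε ≫ redSubι G₁ E₁ hE₁)
    (by rw [hrange, Scheme.IdealSheafData.range_subschemeι, Scheme.IdealSheafData.coe_support_vanishingIdeal]; rfl)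
  exact ⟨hc, e'.hom, by rw [he', hf], inferInstance⟩

/-- The image of an irreducible closed subset is irreducible (T-DIRLIFT-UP's `hΓirr` for `Γ := ϱ '' Z`). [folklore] -/
theorem isIrreducible_image {G G₁ : Scheme.{0}} (ϱ : G ⟶ G₁) {Z : Set G} (hZirr : IsIrreducible Z) : IsIrreducible (ϱ '' Z) :=
  hZirr.image _ ϱ.continuous.continuousOn

/-! ## 2. The root's exceptional trace is reduced; the bridge `ε` -/

/-- **Support bookkeeping at the root**: `supp ((I·𝒪_{X₁})·𝒪_{G₁}) = υ₁⁻¹ Z₀` from the downstairs/upstairs square `j₁ ≫ τ₀ = υ₁ ≫ j₀`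
and the reduced trace `I·𝒪_{G₀} = 𝓘⟨Z₀⟩` of the root (R2/R2′ of `DirLift.Ruled`). [folklore] -/
theorem coe_support_comap_comap_eq_preimage {X₀ X₁ G₀ G₁ : Scheme.{0}} (τ₀ : X₁ ⟶ X₀) (j₀ : G₀ ⟶ X₀) (j₁ : G₁ ⟶ X₁) (υ₁ : G₁ ⟶ G₀)
    (hcomm : j₁ ≫ τ₀ = υ₁ ≫ j₀) (I : X₀.IdealSheafData) {Z₀ : Set G₀} (hZ₀ : IsClosed Z₀)
    (hI : I.comap j₀ = vanishingIdeal (⟨Z₀, hZ₀⟩ : Closeds G₀)) :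
    (((I.comap τ₀).comap j₁).support : Set G₁) = υ₁ ⁻¹' Z₀ := by
  rw [← Scheme.IdealSheafData.comap_comp, hcomm, Scheme.IdealSheafData.comap_comp, hI, Scheme.IdealSheafData.support_comap,
    Closeds.coe_preimage, Scheme.IdealSheafData.coe_support_vanishingIdeal]
  rfl

/-- **The root's exceptional trace is REDUCED, and the special-fibre bridge.** Along the cartesian square `(jG, ϱ, ρ, j₁)` of special
fibres and an isomorphism `e : V(𝓔) ≅ V(J)` over `ρ` (R1′ of `DirLift.Ruled`, `J = I·𝒪_{X₁}`): if the stage's trace `𝓔·𝒪_G = 𝓘⟨E⟩` is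
reduced (Inv₂ (e-i)), then so is the root's — `J·𝒪_{G₁} = 𝓘⟨E₁⟩` for `E₁ = supp (J·𝒪_{G₁})` — and `Ẽ ≅ Ẽ₁` over `ϱ`.
[cite: GortzWedhorn2020, Prop. 4.20] -/
theorem comap_eq_vanishingIdeal_and_exists_isIso_redSub_of_iso_over {X X₁ G G₁ : Scheme.{0}} (ρ : X ⟶ X₁) (jG : G ⟶ X)
    (j₁ : G₁ ⟶ X₁) (ϱ : G ⟶ G₁) (hcart : IsPullback jG ϱ ρ j₁) (𝓔 : X.IdealSheafData) (J : X₁.IdealSheafData)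
    (e : 𝓔.subscheme ≅ J.subscheme) (he : e.hom ≫ J.subschemeι = 𝓔.subschemeι ≫ ρ)
    {E : Set G} (hE : IsClosed E) (hEtr : 𝓔.comap jG = vanishingIdeal (⟨E, hE⟩ : Closeds G))
    {E₁ : Set G₁} (hE₁ : IsClosed E₁) (hsupp : ((J.comap j₁).support : Set G₁) = E₁) :
    J.comap j₁ = vanishingIdeal (⟨E₁, hE₁⟩ : Closeds G₁) ∧
      ∃ ε : redSub G E hE ⟶ redSub G₁ E₁ hE₁, ε ≫ redSubι G₁ E₁ hE₁ = redSubι G E hE ≫ ϱ ∧ IsIso ε := by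
  obtain ⟨δ, -, hδiso⟩ := exists_isIso_subscheme_comap_of_iso_over ρ j₁ jG ϱ hcart J 𝓔 e he
  haveI := hδiso
  haveI : IsReduced (𝓔.comap jG).subscheme := by rw [hEtr]; exact ComponentGluing.isReduced_subscheme_vanishingIdeal _
  haveI : IsReduced (J.comap j₁).subscheme := isReduced_of_isOpenImmersion (inv δ)
  have hJ : J.comap j₁ = vanishingIdeal (⟨E₁, hE₁⟩ : Closeds G₁) := by
    rw [← vanishingIdeal_support_eq_of_isReduced (J.comap j₁)]
    congr 1; ext1; exact hsupp
  exact ⟨hJ, exists_isIso_redSub_of_iso_over ρ j₁ jG ϱ hcart J 𝓔 e he hE₁ hJ hE hEtr⟩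

/-! ## 3. The section at the root -/

/-- **THE SECTION AT THE ROOT.** From the stage's section `δ : Z̃ ≅ Z̃₉` over `γ ≫ υ'` (`DirStepSec`), the root's `δ₀ : Z̃₀ ≅ Z̃₉` over `γ₀`
(R2′) and a morphism `φ : G ⟶ G₀` with `φ ≫ γ₀ = γ ≫ υ'` (R2: `φ = ϱ ≫ υ₁`) mapping `Z` into `Z₀`: an isomorphism `δ' : Z̃ ⟶ Z̃₀` over `φ`
(namely `δ ≫ δ₀⁻¹`). [cite: Hartshorne1977, II Example 3.2.6] -/
theorem exists_dirStepSec_root {F₉ F₁₀ G G₀ : Scheme.{0}} (υ' : F₁₀ ⟶ F₉) (Z₉ : Set F₉) (hZ₉ : IsClosed Z₉)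
    (γ : G ⟶ F₁₀) {Z : Set G} (hZ : IsClosed Z) (hsec : DirStepSec F₉ F₁₀ υ' Z₉ hZ₉ G γ Z hZ)
    (γ₀ : G₀ ⟶ F₉) {Z₀ : Set G₀} (hZ₀ : IsClosed Z₀)
    (hδ₀ : ∃ δ₀ : redSub G₀ Z₀ hZ₀ ⟶ redSub F₉ Z₉ hZ₉, δ₀ ≫ redSubι F₉ Z₉ hZ₉ = redSubι G₀ Z₀ hZ₀ ≫ γ₀ ∧ IsIso δ₀)
    (φ : G ⟶ G₀) (hφ : φ ≫ γ₀ = γ ≫ υ') (hZZ₀ : Z ⊆ φ ⁻¹' Z₀) :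
    ∃ δ' : redSub G Z hZ ⟶ redSub G₀ Z₀ hZ₀, δ' ≫ redSubι G₀ Z₀ hZ₀ = redSubι G Z hZ ≫ φ ∧ IsIso δ' := by
  obtain ⟨δ, hδ, hδiso⟩ := hsec
  obtain ⟨δ₀, hδ₀, hδ₀iso⟩ := hδ₀
  haveI := hδiso
  haveI := hδ₀iso
  haveI : IsReduced (redSub G Z hZ) := ComponentGluing.isReduced_subscheme_vanishingIdeal _
  -- the kernel condition: `Z̃` is reduced and `φ(Z) ⊆ Z₀`
  have hker : (redSubι G₀ Z₀ hZ₀).ker ≤ (redSubι G Z hZ ≫ φ).ker := by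
    rw [Scheme.IdealSheafData.ker_subschemeι, ker_eq_vanishingIdeal_closure_range]
    refine vanishingIdeal_antimono ?_
    change closure (Set.range ⇑(redSubι G Z hZ ≫ φ).base) ⊆ Z₀
    rw [hZ₀.closure_subset_iff]
    rintro _ ⟨y, rfl⟩
    rw [Scheme.Hom.comp_apply]
    exact hZZ₀ (redSubι_mem hZ y)
  refine ⟨IsClosedImmersion.lift _ _ hker, IsClosedImmersion.lift_fac _ _ hker, ?_⟩
  -- `δ' = δ ≫ δ₀⁻¹` after the monomorphism `Z̃₀ ↪ G₀ → F₉ = δ₀ ≫ (Z̃₉ ↪ F₉)`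
  haveI : Mono (redSubι G₀ Z₀ hZ₀ ≫ γ₀) := by rw [← hδ₀]; infer_instance
  have heq : IsClosedImmersion.lift _ _ hker = δ ≫ inv δ₀ := by
    rw [← cancel_mono (redSubι G₀ Z₀ hZ₀ ≫ γ₀), ← Category.assoc, IsClosedImmersion.lift_fac, Category.assoc, hφ, ← hδ,
      Category.assoc, ← hδ₀, IsIso.inv_hom_id_assoc]
  rw [heq]
  infer_instance

/-- **T-DIRLIFT-UP's `hsec` for `Γ := ϱ '' Z`** (sig `TARGET-DIRLIFT-UP.sig.lean` 9b7825e935ffb8f7, verbatim shape): with the bridge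
`ε : Ẽ ≅ Ẽ₁` over `ϱ`, `Z ⊆ E`, the root's `δ₀` and `υ₁ ≫ γ₀`-compatibility `(ϱ ≫ υ₁) ≫ γ₀ = γ ≫ υ'`, `ϱ(E) ⊆ υ₁⁻¹Z₀`: the reduced image
curve `redSub G₁ (ϱ '' Z)` maps isomorphically onto `Z̃₀` over `υ₁`. [cite: Hartshorne1977, II Example 3.2.6] -/
theorem exists_dirStepSec_root_image {F₉ F₁₀ G G₀ G₁ : Scheme.{0}} (υ' : F₁₀ ⟶ F₉) (Z₉ : Set F₉) (hZ₉ : IsClosed Z₉)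
    (γ : G ⟶ F₁₀) {Z : Set G} (hZ : IsClosed Z) (hsec : DirStepSec F₉ F₁₀ υ' Z₉ hZ₉ G γ Z hZ)
    (γ₀ : G₀ ⟶ F₉) {Z₀ : Set G₀} (hZ₀ : IsClosed Z₀)
    (hδ₀ : ∃ δ₀ : redSub G₀ Z₀ hZ₀ ⟶ redSub F₉ Z₉ hZ₉, δ₀ ≫ redSubι F₉ Z₉ hZ₉ = redSubι G₀ Z₀ hZ₀ ≫ γ₀ ∧ IsIso δ₀)
    (υ₁ : G₁ ⟶ G₀) (ϱ : G ⟶ G₁) (hϱ : ϱ ≫ υ₁ ≫ γ₀ = γ ≫ υ')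
    {E : Set G} (hE : IsClosed E) (hZE : Z ⊆ E) {E₁ : Set G₁} (hE₁ : IsClosed E₁) (hEZ₀ : E₁ ⊆ υ₁ ⁻¹' Z₀)
    (ε : redSub G E hE ⟶ redSub G₁ E₁ hE₁) [IsIso ε] (hε : ε ≫ redSubι G₁ E₁ hE₁ = redSubι G E hE ≫ ϱ)
    (hc : IsClosed (ϱ '' Z)) :
    ∃ δ₁ : redSub G₁ (ϱ '' Z) hc ⟶ redSub G₀ Z₀ hZ₀, δ₁ ≫ redSubι G₀ Z₀ hZ₀ = redSubι G₁ (ϱ '' Z) hc ≫ υ₁ ∧ IsIso δ₁ := by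
  have hZZ₀ : Z ⊆ (ϱ ≫ υ₁) ⁻¹' Z₀ := fun z hz =>
    hEZ₀ (image_subset_of_redSub_hom_over ϱ hE hE₁ ε hε ⟨z, hZE hz, rfl⟩)
  obtain ⟨δ', hδ', hδ'iso⟩ := exists_dirStepSec_root υ' Z₉ hZ₉ γ hZ hsec γ₀ hZ₀ hδ₀ (ϱ ≫ υ₁)
    (by rw [Category.assoc, hϱ]) hZZ₀
  obtain ⟨hc', εZ, hεZ, hεZiso⟩ := exists_isIso_redSub_image ϱ hE hE₁ ε hε hZ hZE
  haveI := hδ'iso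
  haveI := hεZiso
  refine ⟨inv εZ ≫ δ', ?_, inferInstance⟩
  rw [Category.assoc, hδ', ← Category.assoc (redSubι G Z hZ), ← hεZ, Category.assoc, IsIso.inv_hom_id_assoc]

/-! ## 4. Regularity of `Ẽ` along the curve transports along `ε` -/

/-- **T-DIRLIFT-UP's `hEreg` for `Γ := ϱ '' Z`** from the round's clause «`Ẽ` is regular along `Z̃`» at the stage (`TowerRound₃`), along the
isomorphisms `ε : Ẽ ≅ Ẽ₁`, `εZ : Z̃ ≅ Γ̃₁` over `ϱ` (the closed immersions `Z̃ ⟶ Ẽ`, `Γ̃₁ ⟶ Ẽ₁` over the ambient spaces are unique and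
correspond under `ε`, `εZ`; regularity of local rings is invariant under isomorphisms). [folklore] -/
theorem forall_isRegularLocalRing_stalk_of_redSub_isos {G G₁ : Scheme.{0}} (ϱ : G ⟶ G₁) {E Z : Set G} (hE : IsClosed E)
    (hZ : IsClosed Z) (hZE : Z ⊆ E) {E₁ Γ₁ : Set G₁} (hE₁ : IsClosed E₁) (hΓ₁ : IsClosed Γ₁)
    (ε : redSub G E hE ⟶ redSub G₁ E₁ hE₁) [IsIso ε] (hε : ε ≫ redSubι G₁ E₁ hE₁ = redSubι G E hE ≫ ϱ)
    (εZ : redSub G Z hZ ⟶ redSub G₁ Γ₁ hΓ₁) [IsIso εZ] (hεZ : εZ ≫ redSubι G₁ Γ₁ hΓ₁ = redSubι G Z hZ ≫ ϱ)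
    (hEreg : ∀ (i : redSub G Z hZ ⟶ redSub G E hE), i ≫ redSubι G E hE = redSubι G Z hZ →
      ∀ x : redSub G Z hZ, IsRegularLocalRing ((redSub G E hE).presheaf.stalk (i x))) :
    ∀ (i₁ : redSub G₁ Γ₁ hΓ₁ ⟶ redSub G₁ E₁ hE₁), i₁ ≫ redSubι G₁ E₁ hE₁ = redSubι G₁ Γ₁ hΓ₁ →
      ∀ x₁ : redSub G₁ Γ₁ hΓ₁, IsRegularLocalRing ((redSub G₁ E₁ hE₁).presheaf.stalk (i₁ x₁)) := by
  intro i₁ hi₁ x₁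
  obtain ⟨i, hi, -⟩ := exists_redSub_hom_of_subset hZ hE hZE
  -- the inclusions correspond under the bridge: `i ≫ ε = εZ ≫ i₁` (cancel the monomorphism `Ẽ₁ ↪ G₁`)
  have hcomm : i ≫ ε = εZ ≫ i₁ := by
    rw [← cancel_mono (redSubι G₁ E₁ hE₁), Category.assoc, hε, ← Category.assoc, hi, Category.assoc, hi₁, hεZ]
  have hpt : i₁ x₁ = ε (i (inv εZ x₁)) := by
    rw [← Scheme.Hom.comp_apply, ← Scheme.Hom.comp_apply, hcomm, IsIso.inv_hom_id_assoc]
  rw [hpt]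
  haveI : IsIso (ε.stalkMap (i (inv εZ x₁))) := ((AlgebraicGeometry.isIso_iff_isIso_stalkMap ε).mp inferInstance).2 _
  haveI := hEreg i hi (inv εZ x₁)
  exact IsRegularLocalRing.of_ringEquiv (asIso (ε.stalkMap (i (inv εZ x₁)))).commRingCatIsoToRingEquiv.symm

end Summit.ResolutionOfSingularities.ResolutionOfSingularities.Cruxes.EquisingularLiftNat.Sections

end
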